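import Mathlib
import Summits.PneNP.PneNP.Theorems.Nc03AvoidResidualCoreCandCutNormCertificate
import Summits.PneNP.PneNP.Theorems.SfmBlDiscToTrace
import Summits.PneNP.PneNP.Theorems.SfmBlSignHoeffding

/-!
# The abstract output-shared-sign model and Prop. 7 on the good event — line «sfm-bl»

FRONTIER F-N1c; nothing here bears on P vs NP.

Abstract model of a (remainder) bipartite multigraph with one sign per OUTPUT: left pieces `α`, right pieces
`β`, outputs `e : Fin m`, `B e : Matrix α β ℝ` = multiplicities of the edges of output `e` (entries `≥ 0`);
for a signing `T : Fin m → Bool` the signed biadjacency is `sgnMat B T = Σ_e χ(T e)·B e`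
(`χ = CandCutNorm.boolSign`, `true ↦ −1`).  Proved here (PROOF-SFM-BL Cor 3′ and the «on 𝒢» step of Prop. 7):
* `abs_disc_sgnMat_le`: signed discrepancy ≤ unsigned edge count on 0/1 pairs;
* `row_abs_sum_sgnMat_le` / `col_abs_sum_sgnMat_le`: ℓ₁-norms of rows/columns ≤ unsigned degrees;
* `connected_disc_of_good`: if every connected pair of size `> t₀` has signed discrepancy `≤ γ'√` (the good
  event) and the unsigned graph is `(γ_sp, t₀)`-sparse on connected pairs, `γ' ≤ γ_sp`, then EVERY connected
  pair has signed discrepancy `≤ γ_sp√`;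
* `trace_pow_le_of_good`: hence (via `trace_pow_le_of_connected_disc`, Bilu–Linial 3.3 with constant 100)
  `tr(A_T^{2k}) ≤ (|α|+|β|)·(100·γ_sp·(log₂(L/γ_sp)+1))^{2k}` for the bipartite double `A_T` of `sgnMat B T`.
What remains of Prop. 7 is the COUNT of bad signings (Hoeffding `card_abs_signSum_ge_le` per connected set +
`card_connectedSets_le`), see HOME/pnp-ideate-p3/r15/SfmBlProp7Targets.lean (target P7b).
-/

namespace Summit.PneNP.PneNP.Theorems.SfmBl

open Matrix Finset BigOperators

variable {α β : Type} [Fintype α] [Fintype β] {m : ℕ}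

/-- The signed biadjacency `Σ_e χ(T e)·B e` of the abstract output-shared-sign model. -/
noncomputable def sgnMat (B : Fin m → Matrix α β ℝ) (T : Fin m → Bool) : Matrix α β ℝ :=
  ∑ e, ((CandCutNorm.boolSign (T e) : ℤ) : ℝ) • B e

omit [Fintype α] [Fintype β] in
/-- Entries of the signed biadjacency. -/
theorem sgnMat_apply (B : Fin m → Matrix α β ℝ) (T : Fin m → Bool) (i : α) (k : β) :
    sgnMat B T i k = ∑ e, ((CandCutNorm.boolSign (T e) : ℤ) : ℝ) * B e i k := by
  simp only [sgnMat, Matrix.sum_apply, Matrix.smul_apply, smul_eq_mul]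

omit [Fintype α] [Fintype β] in
/-- Entrywise `|Σ_e χ_e B_e i k| ≤ Σ_e B_e i k`. -/
theorem abs_sgnMat_apply_le (B : Fin m → Matrix α β ℝ) (hB : ∀ e i k, 0 ≤ B e i k) (T : Fin m → Bool)
    (i : α) (k : β) : |sgnMat B T i k| ≤ (∑ e, B e) i k := by
  rw [sgnMat_apply, Matrix.sum_apply]
  refine (Finset.abs_sum_le_sum_abs _ _).trans (Finset.sum_le_sum fun e _ => ?_)
  rw [abs_mul, abs_boolSign_cast, one_mul, abs_of_nonneg (hB e i k)]

omit [Fintype α] [Fintype β] in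
/-- A non-zero signed entry comes from some leg: `sgnMat B T i k ≠ 0 → ∃ e, B e i k ≠ 0`. -/
theorem exists_ne_zero_of_sgnMat_ne_zero (B : Fin m → Matrix α β ℝ) (T : Fin m → Bool) (i : α) (k : β)
    (h : sgnMat B T i k ≠ 0) : ∃ e, B e i k ≠ 0 := by
  by_contra hne
  push Not at hne
  apply h
  rw [sgnMat_apply]
  exact Finset.sum_eq_zero fun e _ => by rw [hne e, mul_zero]

omit [Fintype α] in
/-- Row ℓ₁-norms of the signed matrix are at most the unsigned row degrees. -/
theorem row_abs_sum_sgnMat_le (B : Fin m → Matrix α β ℝ) (hB : ∀ e i k, 0 ≤ B e i k) (T : Fin m → Bool)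
    (i : α) : ∑ k, |sgnMat B T i k| ≤ ∑ e, ∑ k, B e i k := by
  calc ∑ k, |sgnMat B T i k| ≤ ∑ k, (∑ e, B e) i k :=
        Finset.sum_le_sum fun k _ => abs_sgnMat_apply_le B hB T i k
    _ = ∑ e, ∑ k, B e i k := by
        simp only [Matrix.sum_apply]
        rw [Finset.sum_comm]

omit [Fintype β] in
/-- Column ℓ₁-norms of the signed matrix are at most the unsigned column degrees. -/
theorem col_abs_sum_sgnMat_le (B : Fin m → Matrix α β ℝ) (hB : ∀ e i k, 0 ≤ B e i k) (T : Fin m → Bool)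
    (k : β) : ∑ i, |sgnMat B T i k| ≤ ∑ e, ∑ i, B e i k := by
  calc ∑ i, |sgnMat B T i k| ≤ ∑ i, (∑ e, B e) i k :=
        Finset.sum_le_sum fun i _ => abs_sgnMat_apply_le B hB T i k
    _ = ∑ e, ∑ i, B e i k := by
        simp only [Matrix.sum_apply]
        rw [Finset.sum_comm]

/-- The signed bilinear form splits over outputs: `uᵀ(Σ_e χ_e B_e)v = Σ_e χ_e·uᵀB_e v`. -/
theorem dotProduct_sgnMat_mulVec (B : Fin m → Matrix α β ℝ) (T : Fin m → Bool) (u : α → ℝ) (v : β → ℝ) :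
    u ⬝ᵥ (sgnMat B T *ᵥ v) = ∑ e, ((CandCutNorm.boolSign (T e) : ℤ) : ℝ) * (u ⬝ᵥ (B e *ᵥ v)) := by
  simp only [sgnMat, Matrix.sum_mulVec, Matrix.smul_mulVec, dotProduct_sum, dotProduct_smul, smul_eq_mul]

/-- COR 3′ (signed ≤ unsigned): for 0/1 vectors, `|uᵀ(Σ_e χ_e B_e)v| ≤ uᵀ(Σ_e B_e)v`. -/
theorem abs_disc_sgnMat_le (B : Fin m → Matrix α β ℝ) (hB : ∀ e i k, 0 ≤ B e i k) (T : Fin m → Bool)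
    (u : α → ℝ) (v : β → ℝ) (hu : ∀ i, u i = 0 ∨ u i = 1) (hv : ∀ k, v k = 0 ∨ v k = 1) :
    |u ⬝ᵥ (sgnMat B T *ᵥ v)| ≤ u ⬝ᵥ ((∑ e, B e) *ᵥ v) := by
  have hu0 : ∀ i, 0 ≤ u i := fun i => by rcases hu i with h | h <;> simp [h]
  have hv0 : ∀ k, 0 ≤ v k := fun k => by rcases hv k with h | h <;> simp [h]
  have hx : ∀ e, 0 ≤ u ⬝ᵥ (B e *ᵥ v) := fun e =>
    Finset.sum_nonneg fun i _ => mul_nonneg (hu0 i)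
      (Finset.sum_nonneg fun k _ => mul_nonneg (hB e i k) (hv0 k))
  rw [dotProduct_sgnMat_mulVec, Matrix.sum_mulVec, dotProduct_sum]
  refine (Finset.abs_sum_le_sum_abs _ _).trans (Finset.sum_le_sum fun e _ => ?_)
  rw [abs_mul, abs_boolSign_cast, one_mul, abs_of_nonneg (hx e)]

/-- PROP. 7, «ON 𝒢» STEP: if every connected pair of size `> t₀` has signed discrepancy `≤ γ'√(ab)` and the
unsigned graph is `(γ_sp, t₀)`-sparse on connected pairs (`a + b ≤ t₀ ⇒ uᵀ(Σ_e B_e)v ≤ γ_sp√(ab)`),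
`γ' ≤ γ_sp`, then every connected pair has signed discrepancy `≤ γ_sp√(ab)`. -/
theorem connected_disc_of_good (B : Fin m → Matrix α β ℝ) (hB : ∀ e i k, 0 ≤ B e i k)
    (G : SimpleGraph (α ⊕ β)) {γ' γsp : ℝ} (hγ : γ' ≤ γsp) (t₀ : ℕ) (T : Fin m → Bool)
    (hsparse : ∀ (u : α → ℝ) (v : β → ℝ), (∀ i, u i = 0 ∨ u i = 1) → (∀ k, v k = 0 ∨ v k = 1) →
      (G.induce {x | Sum.elim u v x = 1}).Connected → (∑ i, u i) + (∑ k, v k) ≤ t₀ →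
      u ⬝ᵥ ((∑ e, B e) *ᵥ v) ≤ γsp * Real.sqrt ((∑ i, u i) * (∑ k, v k)))
    (hgood : ∀ (u : α → ℝ) (v : β → ℝ), (∀ i, u i = 0 ∨ u i = 1) → (∀ k, v k = 0 ∨ v k = 1) →
      (G.induce {x | Sum.elim u v x = 1}).Connected → (t₀ : ℝ) < (∑ i, u i) + (∑ k, v k) →
      |u ⬝ᵥ (sgnMat B T *ᵥ v)| ≤ γ' * Real.sqrt ((∑ i, u i) * (∑ k, v k)))
    (u : α → ℝ) (v : β → ℝ) (hu : ∀ i, u i = 0 ∨ u i = 1) (hv : ∀ k, v k = 0 ∨ v k = 1)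
    (hconn : (G.induce {x | Sum.elim u v x = 1}).Connected) :
    |u ⬝ᵥ (sgnMat B T *ᵥ v)| ≤ γsp * Real.sqrt ((∑ i, u i) * (∑ k, v k)) := by
  by_cases hsize : (∑ i, u i) + (∑ k, v k) ≤ t₀
  · exact (abs_disc_sgnMat_le B hB T u v hu hv).trans (hsparse u v hu hv hconn hsize)
  · push Not at hsize
    exact (hgood u v hu hv hconn hsize).trans
      (mul_le_mul_of_nonneg_right hγ (Real.sqrt_nonneg _))

/-- PROP. 7, DETERMINISTIC CONCLUSION ON THE GOOD EVENT: under the hypotheses of `connected_disc_of_good`,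
unsigned one-sided degrees `≤ L`, `0 < γ_sp ≤ L`, and `G` containing every leg, the bipartite double of the
signed matrix has `tr(A_T^{2k}) ≤ (|α|+|β|)·(100·γ_sp·(log₂(L/γ_sp)+1))^{2k}`. -/
theorem trace_pow_le_of_good [DecidableEq α] [DecidableEq β] (B : Fin m → Matrix α β ℝ)
    (hB : ∀ e i k, 0 ≤ B e i k) (G : SimpleGraph (α ⊕ β))
    (hG : ∀ e i k, B e i k ≠ 0 → G.Adj (Sum.inl i) (Sum.inr k))
    {L γ' γsp : ℝ} (hγsp : 0 < γsp) (hγspL : γsp ≤ L) (hγ : γ' ≤ γsp)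
    (hrow : ∀ i, ∑ e, ∑ k, B e i k ≤ L) (hcol : ∀ k, ∑ e, ∑ i, B e i k ≤ L)
    (t₀ : ℕ) (T : Fin m → Bool)
    (hsparse : ∀ (u : α → ℝ) (v : β → ℝ), (∀ i, u i = 0 ∨ u i = 1) → (∀ k, v k = 0 ∨ v k = 1) →
      (G.induce {x | Sum.elim u v x = 1}).Connected → (∑ i, u i) + (∑ k, v k) ≤ t₀ →
      u ⬝ᵥ ((∑ e, B e) *ᵥ v) ≤ γsp * Real.sqrt ((∑ i, u i) * (∑ k, v k)))
    (hgood : ∀ (u : α → ℝ) (v : β → ℝ), (∀ i, u i = 0 ∨ u i = 1) → (∀ k, v k = 0 ∨ v k = 1) →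
      (G.induce {x | Sum.elim u v x = 1}).Connected → (t₀ : ℝ) < (∑ i, u i) + (∑ k, v k) →
      |u ⬝ᵥ (sgnMat B T *ᵥ v)| ≤ γ' * Real.sqrt ((∑ i, u i) * (∑ k, v k)))
    (k : ℕ) :
    ((Matrix.fromBlocks (0 : Matrix α α ℝ) (sgnMat B T) (sgnMat B T)ᵀ (0 : Matrix β β ℝ))
        ^ (2 * k)).trace
      ≤ (Fintype.card α + Fintype.card β) * (100 * (γsp * (Real.logb 2 (L / γsp) + 1))) ^ (2 * k) := by
  refine trace_pow_le_of_connected_disc (sgnMat B T) G ?_ hγsp hγspL ?_ ?_ ?_ k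
  · intro i k' hik
    obtain ⟨e, he⟩ := exists_ne_zero_of_sgnMat_ne_zero B T i k' hik
    exact hG e i k' he
  · exact fun i => (row_abs_sum_sgnMat_le B hB T i).trans (hrow i)
  · exact fun k' => (col_abs_sum_sgnMat_le B hB T k').trans (hcol k')
  · exact fun u v hu hv hconn => connected_disc_of_good B hB G hγ t₀ T hsparse hgood u v hu hv hconn

end Summit.PneNP.PneNP.Theorems.SfmBl
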